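import Literature.AlgebraicGeometry.HodgeTheory.PicardLefschetzNodalForms
import Literature.AlgebraicGeometry.HodgeTheory.DiagonalSymmetryEigenHodgeNumbers
import HarnessLib

/-!
# Two nodes exchanged by a diagonal symmetry: the symmetry swaps them both ways, and an eigen-monomial
# separating them exists (algebraic preliminaries of programme «PL2-MERIDIANS»)

Family `hodge`, layer `Literature/AlgebraicGeometry/HodgeTheory`. Theorems only. Written by the prover seat
`hodge-nonav-20241-p1` (g18, cell `hodge-nonav`) for the registry binder hPL₂exch = `picardLefschetz_exchangedPair`
(crux K1-B, stmt-HodgeConjecture-19716), whose hypotheses give a nodal form `f₁` with exactly two nodes `[p₀], [p₁]`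
and a diagonal `a ∈ (ℂˣ)ⁿ⁺²` stabilising `f₁` with `a • p₁ ∝ p₀`.

* `IsNodalFormWithNodes.exists_smul_eq_swap` — then also `a • p₀ ∝ p₁`: `a • p₀` is a singular point of `f₁`
  (`f₁(a • x) = f₁(x)`), hence a node; it cannot be `∝ p₀`, else `[p₁] = [a⁻¹ • p₀] = [p₀]`.
* `exists_eigenMonomial_separating` — there is a monomial `x^m` of degree `d` with `p₀^m ≠ 0` and `a^m ≠ 1`
  (otherwise `a` acts on the support of `p₀` by a scalar and `[p₁] = [a⁻¹ • p₀] = [p₀]`); for `h := x^m` this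
  gives `h(a • x) = a^m h(x)` (`aeval_diagonalSubst_monomial_smul`) and the TRANSVERSALITY
  `g(p₀) h(p₁) ≠ h(p₀) g(p₁)` of the two-parameter unfolding `f₁ + u g + v h` for every `a`-invariant `g` with
  `g(p₀) ≠ 0` (`transversal_of_eigenMonomial`).

Honest scope: elementary algebra; nothing about monodromy or HC.

## References

* [VoisinHodgeII2003] C. Voisin, Hodge Theory and Complex Algebraic Geometry II, CUP 2003, §2.3.1.
* [ArnoldGuseinzadeVarchenko2012] AGZV II, Part I §5.2 (symmetric unfoldings).
-/

noncomputable section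

open MvPolynomial
open Literature.AlgebraicGeometry.Motives

namespace Literature.AlgebraicGeometry.HodgeTheory

variable {n d : ℕ} {f₁ : MvPolynomial (Fin (n + 2)) ℂ} {p : Fin 2 → Fin (n + 2) → ℂ} {a : Fin (n + 2) → ℂˣ}

/-- Partials of an `a`-invariant form transfer along `x ↦ a • x`: if `∇F(z) = 0` then `∇F(a • z) = 0`.
[cite: VoisinHodgeII2003, §2.3.1] -/
theorem forall_eval_pderiv_smul_eq_zero_of_mem_diagonalStabilizer {F : MvPolynomial (Fin (n + 2)) ℂ}
    (ha : a ∈ diagonalStabilizer F) {z : Fin (n + 2) → ℂ} (hz : ∀ j, eval z (pderiv j F) = 0) (j : Fin (n + 2)) :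
    eval (a • z) (pderiv j F) = 0 := by
  have h := hz j
  conv_lhs at h => rw [← mem_diagonalStabilizer_iff.mp ha]
  rw [pderiv_aeval_diagonalSubst, smul_eval, eval_aeval_diagonalSubst] at h
  exact (mul_eq_zero.1 h).resolve_left (Units.ne_zero (a j))

/-- Scalars commute with the diagonal action. [folklore] -/
private theorem diagonal_smul_comm (b : Fin (n + 2) → ℂˣ) (c : ℂ) (x : Fin (n + 2) → ℂ) : b • (c • x) = c • (b • x) := by
  funext i; simp only [Pi.smul_apply, smul_apply_eq_mul, smul_eq_mul]; ring

/-- **A diagonal symmetry exchanging two nodes one way exchanges them the other way.** For a nodal form `f₁`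
whose singular points are exactly `[p₀], [p₁]`, and `a ∈ diagonalStabilizer f₁` with `a • p₁ = t • p₀`: also
`a • p₀ = t' • p₁` for some `t'`. [cite: VoisinHodgeII2003, §2.3.1] [cite: ArnoldGuseinzadeVarchenko2012, Part I §5.2] -/
theorem IsNodalFormWithNodes.exists_smul_eq_swap (hnod : IsNodalFormWithNodes f₁ p) (ha : a ∈ diagonalStabilizer f₁)
    (h10 : ∃ t : ℂ, a • p 1 = t • p 0) : ∃ t : ℂ, a • p 0 = t • p 1 := by
  have hp0 : p 0 ≠ 0 := (hnod.1 0).ne_zero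
  have hz0 : a • p 0 ≠ 0 := fun h => hp0 (by
    have := congrArg (fun x => a⁻¹ • x) h
    simpa using this)
  have hpart : ∀ j, eval (a • p 0) (pderiv j f₁) = 0 := fun j =>
    forall_eval_pderiv_smul_eq_zero_of_mem_diagonalStabilizer ha (hnod.1 0).eval_pderiv j
  obtain ⟨i, t, hit⟩ := hnod.2.2 (a • p 0) hz0 hpart
  fin_cases i
  · -- `a • p₀ = t • p₀` is impossible
    exfalso
    obtain ⟨t', ht'⟩ := h10
    have ht0 : t ≠ 0 := by
      rintro rfl; rw [zero_smul] at hit; exact hz0 hit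
    have hinv : a⁻¹ • p 0 = t⁻¹ • p 0 := by
      have h := congrArg (fun x => t⁻¹ • (a⁻¹ • x)) hit
      simp only [inv_smul_smul] at h
      rw [diagonal_smul_comm, smul_smul, inv_mul_cancel₀ ht0, one_smul] at h
      exact h.symm
    have h1 : p 1 = (t' * t⁻¹) • p 0 := by
      have h := congrArg (fun x => a⁻¹ • x) ht'
      simp only [inv_smul_smul] at h
      rw [h, diagonal_smul_comm, hinv, smul_smul]
    have := hnod.2.1 1 0 ⟨t' * t⁻¹, h1⟩
    exact absurd this (by decide)
  · exact ⟨t, hit⟩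

/-- **An eigen-monomial separating two exchanged points.** If `p₀ ≠ 0`, `p₁` is no multiple of `p₀`, and
`a • p₁ = t • p₀`, then some monomial `m` of degree `d ≥ 1` has `p₀^m ≠ 0` and `a^m ≠ 1`. (Otherwise, on the
support `J` of `p₀`, comparing `m = x_{i₀}^{d-1}x_j` and `x_{i₀}^d` gives `a_j = a_{i₀}` for all `j ∈ J`, so
`a • p₀ = a_{i₀} • p₀` and `p₁ = t a_{i₀}⁻¹ • p₀`.) [cite: ArnoldGuseinzadeVarchenko2012, Part I §5.2] -/
theorem exists_eigenMonomial_separating (hd : 1 ≤ d) (hp0 : p 0 ≠ 0) (hne : ∀ t : ℂ, p 1 ≠ t • p 0)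
    (h10 : ∃ t : ℂ, a • p 1 = t • p 0) :
    ∃ m : Fin (n + 2) →₀ ℕ, m.degree = d ∧ (∏ i, p 0 i ^ m i) ≠ 0 ∧ (∏ i, ((a i : ℂˣ) : ℂ) ^ m i) ≠ 1 := by
  classical
  by_contra H
  push Not at H
  -- a coordinate in the support of `p₀`
  obtain ⟨i₀, hi₀⟩ : ∃ i, p 0 i ≠ 0 := by
    by_contra h; push Not at h; exact hp0 (funext h)
  -- the monomials `x_{i₀}^{d-1} x_j`
  have key : ∀ j, p 0 j ≠ 0 → ((a i₀ : ℂ) ^ (d - 1)) * (a j : ℂ) = 1 := by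
    intro j hj
    set m : Fin (n + 2) →₀ ℕ := Finsupp.single i₀ (d - 1) + Finsupp.single j 1 with hm
    have hdeg : m.degree = d := by
      rw [hm, map_add, Finsupp.degree_single, Finsupp.degree_single]; omega
    have hsingle : ∀ (x : Fin (n + 2) → ℂ) (i : Fin (n + 2)) (k : ℕ),
        ∏ l, x l ^ (Finsupp.single i k : Fin (n + 2) →₀ ℕ) l = x i ^ k := by
      intro x i k
      rw [Finset.prod_eq_single i (fun l _ hl => by rw [Finsupp.single_eq_of_ne hl, pow_zero])
        (fun h => (h (Finset.mem_univ _)).elim), Finsupp.single_eq_same]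
    have hprod : ∀ (x : Fin (n + 2) → ℂ), ∏ i, x i ^ m i = x i₀ ^ (d - 1) * x j := by
      intro x
      have h1 : ∀ i, x i ^ m i = x i ^ (Finsupp.single i₀ (d - 1) : Fin (n + 2) →₀ ℕ) i *
          x i ^ (Finsupp.single j 1 : Fin (n + 2) →₀ ℕ) i := fun i => by
        rw [hm, Finsupp.add_apply, pow_add]
      rw [Finset.prod_congr rfl fun i _ => h1 i, Finset.prod_mul_distrib, hsingle, hsingle, pow_one]
    have hval : ∏ i, p 0 i ^ m i ≠ 0 := by
      rw [hprod]; exact mul_ne_zero (pow_ne_zero _ hi₀) hj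
    have h1 := H m hdeg hval
    rwa [hprod] at h1
  have hi₀d : (a i₀ : ℂ) ^ d = 1 := by
    have h := key i₀ hi₀
    rwa [← pow_succ, Nat.sub_add_cancel hd] at h
  have haj : ∀ j, p 0 j ≠ 0 → (a j : ℂ) = a i₀ := by
    intro j hj
    have h1 := key j hj
    have h2 := key i₀ hi₀
    have hne0 : ((a i₀ : ℂ) ^ (d - 1)) ≠ 0 := pow_ne_zero _ (Units.ne_zero _)
    exact mul_left_cancel₀ hne0 (h1.trans h2.symm)
  -- so `a • p₀ = a_{i₀} • p₀`
  have hap : a • p 0 = (a i₀ : ℂ) • p 0 := by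
    funext k
    rw [smul_apply_eq_mul, Pi.smul_apply, smul_eq_mul]
    by_cases hk : p 0 k = 0
    · rw [hk, mul_zero, mul_zero]
    · rw [haj k hk]
  -- and `p₁ ∝ p₀`
  obtain ⟨t, ht⟩ := h10
  have hai₀ : (a i₀ : ℂ) ≠ 0 := Units.ne_zero _
  apply hne (t * (a i₀ : ℂ)⁻¹)
  have h := congrArg (fun x => a⁻¹ • x) ht
  simp only [inv_smul_smul] at h
  have hinv : a⁻¹ • p 0 = (a i₀ : ℂ)⁻¹ • p 0 := by
    have h' := congrArg (fun x => (a i₀ : ℂ)⁻¹ • (a⁻¹ • x)) hap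
    simp only [inv_smul_smul] at h'
    rw [diagonal_smul_comm, smul_smul, inv_mul_cancel₀ hai₀, one_smul] at h'
    exact h'.symm
  rw [h, diagonal_smul_comm, hinv, smul_smul]

/-- The monomial eigen-relation `x^m(a • z) = a^m · x^m(z)` as a polynomial identity for `h := monomial m 1`.
[cite: VoisinHodgeII2003, §6.1.3] -/
theorem aeval_diagonalSubst_monomial_one (a : Fin (n + 2) → ℂˣ) (m : Fin (n + 2) →₀ ℕ) :
    aeval (diagonalSubst a) (monomial m (1 : ℂ)) = (∏ i, ((a i : ℂˣ) : ℂ) ^ m i) • monomial m (1 : ℂ) :=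
  aeval_diagonalSubst_monomial_smul a m 1

/-- Evaluation of the monomial `x^m`. [folklore] -/
private theorem eval_monomial_one (x : Fin (n + 2) → ℂ) (m : Fin (n + 2) →₀ ℕ) :
    eval x (monomial m (1 : ℂ)) = ∏ i, x i ^ m i := by
  rw [eval_monomial, one_mul, Finsupp.prod_fintype m (fun i r => x i ^ r) (fun _ => pow_zero _)]

/-- **Transversality of the symmetric unfolding.** For `g, h` with `g(a⁻¹ • x) = g(x)`, `h` an eigenform
`h(a • x) = χ h(x)` (`χ` a unit, `χ ≠ 1`), `g(p₀) ≠ 0`, `h(p₀) ≠ 0` and `a • p₁ = t • p₀` with `t ≠ 0`: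
`g(p₀) h(p₁) ≠ h(p₀) g(p₁)`, i.e. the differentials `(g(pᵢ), h(pᵢ))` of the two branch functions are
independent. [cite: VoisinHodgeII2003, §2.1.1 Cor. 2.8 and p. 70] -/
theorem transversal_of_eigenform {g h : MvPolynomial (Fin (n + 2)) ℂ} {χ t : ℂ} (hag : a ∈ diagonalStabilizer g)
    (hh : aeval (diagonalSubst a) h = χ • h) (hχ1 : χ ≠ 1) (hχ0 : χ ≠ 0) {e : ℕ} (hge : g.IsHomogeneous e)
    (hhe : h.IsHomogeneous e) (hg0 : eval (p 0) g ≠ 0) (hh0 : eval (p 0) h ≠ 0) (ht : a • p 1 = t • p 0)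
    (ht0 : t ≠ 0) : eval (p 0) g * eval (p 1) h ≠ eval (p 0) h * eval (p 1) g := by
  -- `p₁ = t • a⁻¹ • p₀`, and `g(a⁻¹ • x) = g(x)`, `h(a⁻¹ • x) = χ⁻¹ h(x)`
  have hp1 : p 1 = t • (a⁻¹ • p 0) := by
    have h := congrArg (fun x => a⁻¹ • x) ht
    simp only [inv_smul_smul] at h
    rw [h, diagonal_smul_comm]
  have hga : ∀ z : Fin (n + 2) → ℂ, eval (a⁻¹ • z) g = eval z g := fun z =>
    eval_smul_of_mem_diagonalStabilizer ((diagonalStabilizer g).inv_mem hag) z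
  have hha : ∀ z : Fin (n + 2) → ℂ, eval (a⁻¹ • z) h = χ⁻¹ * eval z h := by
    intro z
    have h1 : eval (a • (a⁻¹ • z)) h = χ * eval (a⁻¹ • z) h := by
      rw [← eval_aeval_diagonalSubst, hh, smul_eval]
    rw [smul_inv_smul] at h1
    rw [h1, ← mul_assoc, inv_mul_cancel₀ hχ0, one_mul]
  rw [hp1, eval_smul_of_isHomogeneous hge, eval_smul_of_isHomogeneous hhe, hga, hha]
  intro heq
  have : eval (p 0) g * (t ^ e * (χ⁻¹ * eval (p 0) h)) - eval (p 0) h * (t ^ e * eval (p 0) g) =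
      t ^ e * eval (p 0) g * eval (p 0) h * (χ⁻¹ - 1) := by ring
  have h0 : t ^ e * eval (p 0) g * eval (p 0) h * (χ⁻¹ - 1) = 0 := by rw [← this, heq, sub_self]
  rcases mul_eq_zero.1 h0 with h1 | h1
  · rcases mul_eq_zero.1 h1 with h2 | h2
    · rcases mul_eq_zero.1 h2 with h3 | h3
      · exact pow_ne_zero _ ht0 h3
      · exact hg0 h3
    · exact hh0 h2
  · apply hχ1
    have : χ⁻¹ = 1 := sub_eq_zero.1 h1
    rw [← inv_inv χ, this, inv_one]

end Literature.AlgebraicGeometry.HodgeTheory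

end
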